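import Mathlib.MeasureTheory.Measure.Decomposition.RadonNikodym
import Literature.Analysis.Complex.LaplaceDecaySupportMeasure
import HarnessLib

/-!
# Exponential decay of a Laplace transform: measurable densities and signed pairs of measures

Topic `Literature/Analysis/Complex`, continuing `LaplaceDecaySupportMeasure`
(`ae_eq_zero_of_laplace_exp_decay_measure`: for a finite positive measure `m` on `[0, ∞)` and a
bounded CONTINUOUS density `S`, `‖∫ e^{-lX} S dm‖ ≤ C e^{-κX}` for large `X` forces `S = 0`
`m`-a.e. on `(-∞, κ)`). Everything in this file is PROVED (no named facts). Two upgrades used by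
the shell-peeling of lattice sums:

* `ae_eq_zero_of_laplace_exp_decay_measure_of_measurable` — the same with `S` merely measurable
  and bounded `m`-a.e. (the proof of the continuous version only used measurability: Laplace
  transform of `S dm|_{(-∞,κ)}` times `e^{κ z}` is entire of exponential type, bounded on the left
  half-plane and on the positive axis, hence constant `= 0` by Phragmén–Lindelöf and Liouville,
  and Fourier uniqueness for finite measures finishes);
* **`eqOn_zero_of_laplace_exp_decay_signedPair`** — SIGNED PAIRS: `m₁, m₂` finite positive
  measures on `[0, ∞)`, `σ` bounded continuous, `α, β ∈ ℂ`, and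
  `‖∫ e^{-lX} σ (α dm₁ - β dm₂)‖ ≤ C e^{-κX}` for large `X`. If on an interval `(a, b) ⊆ (-∞, κ]`
  the second measure is dominated, `m₂ A ≤ q · m₁ A` for measurable `A ⊆ (a, b)` with
  `‖β‖ q < ‖α‖`, and `m₁` charges every sub-interval of `(a, b)`, then `σ = 0` on `(a, b)`
  (Radon–Nikodym with respect to `m = m₁ + m₂`: the density `σ (α ρ₁ - β ρ₂)` vanishes `m`-a.e.
  on `(-∞, κ)` by the measurable version, `‖α ρ₁ - β ρ₂‖ ≥ (‖α‖ - ‖β‖ q) ρ₁ > 0` `m`-a.e. on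
  `(a, b)`, so `σ = 0` `m₁`-a.e. on `(a, b)`, and continuity of `σ` concludes).

## References

* [Boas1954] R. P. Boas, *Entire Functions*, Academic Press 1954, §5.3–§5.4 (Pólya's indicator
  theorem for Laplace–Borel / Laplace–Stieltjes transforms; real-axis form).

What is NOT here: unbounded densities, signed pairs with a non-constant ratio bound (only the
constant domination `m₂ ≤ q m₁` on one interval is treated), and the converse direction
(support in `[κ, ∞)` implies decay), which is elementary.
-/

noncomputable section

namespace Literature.Analysis.Complex

open _root_.MeasureTheory Set Filter Metric Bornology _root_.Complex
open scoped Real Topology ENNReal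

/-- **Exponential decay of the Laplace transform forces a MEASURABLE bounded density to vanish
near `0`.** As `ae_eq_zero_of_laplace_exp_decay_measure`, with `S` measurable and bounded `m`-a.e.
instead of continuous and bounded: if `m` is a finite positive measure on `ℝ` with
`m (-∞, 0) = 0`, `‖S‖ ≤ M` `m`-a.e., `κ > 0` and `‖∫ e^{-lX} S(l) dm(l)‖ ≤ C e^{-κX}` for all
real `X ≥ X₀`, then `S = 0` `m`-a.e. on `(-∞, κ)` (Boas, *Entire Functions*, 1954, §5.3–§5.4:
Pólya's indicator theorem for Laplace–Stieltjes transforms, real-axis form, via Phragmén–Lindelöf,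
Liouville and injectivity of the characteristic function of finite measures).
[cite: Boas1954, §5.4] -/
theorem ae_eq_zero_of_laplace_exp_decay_measure_of_measurable {m : MeasureTheory.Measure ℝ}
    [MeasureTheory.IsFiniteMeasure m]
    (hsupp : m (Set.Iio 0) = 0) {S : ℝ → ℂ} (hS : Measurable S) {M : ℝ} (hSM : ∀ᵐ l ∂m, ‖S l‖ ≤ M)
    {κ C X₀ : ℝ} (hκ : 0 < κ)
    (hdecay : ∀ X : ℝ, X₀ ≤ X →
      ‖∫ l, Complex.exp (-(l : ℂ) * X) * S l ∂m‖ ≤ C * Real.exp (-κ * X)) :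
    ∀ᵐ l ∂m, l < κ → S l = 0 := by
  -- `m` is carried by `[0, ∞)`
  have h0 : ∀ᵐ l ∂m, 0 ≤ l := by
    filter_upwards [measure_eq_zero_iff_ae_notMem.1 hsupp] with l hl using not_lt.1 hl
  -- replace the bound `M` by `M₀ = max M 0 ≥ 0`
  set M₀ : ℝ := max M 0 with hM₀def
  have hM0 : 0 ≤ M₀ := le_max_right _ _
  have hSM₀ : ∀ᵐ l ∂m, ‖S l‖ ≤ M₀ := hSM.mono fun l hl => hl.trans (le_max_left _ _)
  have hSm : ∀ μ : Measure ℝ, AEStronglyMeasurable S μ := fun μ => hS.aestronglyMeasurable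
  -- the piece `m₁ = m|_{(-∞, κ)}`, its Laplace transform `G₁` and `E = e^{κ z} G₁`
  set m₁ : Measure ℝ := m.restrict (Iio κ) with hm₁def
  have hsupp₁ : ∀ᵐ l ∂m₁, l ∈ Ico 0 κ := by
    filter_upwards [ae_restrict_mem (μ := m) (measurableSet_Iio (a := κ)),
      ae_restrict_of_ae (s := Iio κ) h0] with l h1 h2
    exact ⟨h2, h1⟩
  have hSM₁ : ∀ᵐ l ∂m₁, ‖S l‖ ≤ M₀ := ae_restrict_of_ae hSM₀
  set G₁ : ℂ → ℂ := fun z => ∫ l, cexp (-(l : ℂ) * z) * S l ∂m₁ with hG₁def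
  set E : ℂ → ℂ := fun z => cexp (κ * z) * G₁ z with hEdef
  set L : ℝ := M₀ * m.real univ with hLdef
  set L₁ : ℝ := M₀ * m₁.real univ with hL₁def
  have hL₁0 : 0 ≤ L₁ := mul_nonneg hM0 measureReal_nonneg
  -- splitting off the tail `[κ, ∞)`: for real `X ≥ 0`
  have htail : ∀ X : ℝ, 0 ≤ X →
      ‖G₁ X‖ ≤ ‖∫ l, cexp (-(l : ℂ) * X) * S l ∂m‖ + Real.exp (-κ * X) * L := by
    intro X hX
    have hint : Integrable (fun l : ℝ => cexp (-(l : ℂ) * X) * S l) m := by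
      refine Integrable.of_bound ((Continuous.aestronglyMeasurable (by fun_prop)).mul (hSm m))
        M₀ ?_
      filter_upwards [h0, hSM₀] with l hl hSl
      rw [norm_mul, norm_cexp_neg_ofReal_mul, ofReal_re]
      refine (mul_le_of_le_one_left (norm_nonneg _) (Real.exp_le_one_iff.2 ?_)).trans hSl
      nlinarith
    have hsplit := integral_add_compl (measurableSet_Iio (a := κ)) hint
    have hm₂ : (m.restrict (Iio κ)ᶜ).real univ ≤ m.real univ := by
      simp only [measureReal_def]
      exact ENNReal.toReal_mono (measure_ne_top _ _) (Measure.restrict_apply_le _ _)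
    have h2 : ‖∫ l in (Iio κ)ᶜ, cexp (-(l : ℂ) * X) * S l ∂m‖ ≤ Real.exp (-κ * X) * L := by
      have hb : ∀ᵐ (l : ℝ) ∂m.restrict (Iio κ)ᶜ,
          ‖cexp (-(l : ℂ) * X) * S l‖ ≤ Real.exp (-κ * X) * M₀ := by
        filter_upwards [ae_restrict_mem (μ := m) (measurableSet_Iio (a := κ)).compl,
          ae_restrict_of_ae (s := (Iio κ)ᶜ) hSM₀] with l hl hSl
        rw [mem_compl_iff, mem_Iio, not_lt] at hl
        rw [norm_mul, norm_cexp_neg_ofReal_mul, ofReal_re]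
        refine mul_le_mul (Real.exp_le_exp.2 ?_) hSl (norm_nonneg _) (Real.exp_pos _).le
        nlinarith
      calc ‖∫ l in (Iio κ)ᶜ, cexp (-(l : ℂ) * X) * S l ∂m‖
          ≤ Real.exp (-κ * X) * M₀ * (m.restrict (Iio κ)ᶜ).real univ :=
            norm_integral_le_of_norm_le_const hb
        _ ≤ Real.exp (-κ * X) * M₀ * m.real univ := by gcongr
        _ = Real.exp (-κ * X) * L := by rw [hLdef, mul_assoc]
    calc ‖G₁ X‖ = ‖(∫ l, cexp (-(l : ℂ) * X) * S l ∂m) -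
          ∫ l in (Iio κ)ᶜ, cexp (-(l : ℂ) * X) * S l ∂m‖ := by
          rw [← hsplit, add_sub_cancel_right]
      _ ≤ ‖∫ l, cexp (-(l : ℂ) * X) * S l ∂m‖ +
          ‖∫ l in (Iio κ)ᶜ, cexp (-(l : ℂ) * X) * S l ∂m‖ := norm_sub_le _ _
      _ ≤ ‖∫ l, cexp (-(l : ℂ) * X) * S l ∂m‖ + Real.exp (-κ * X) * L := by gcongr
  -- `E` is entire, of exponential type `κ`, bounded on the closed left half-plane
  have hEd : Differentiable ℂ E :=
    ((differentiable_id.const_mul (κ : ℂ)).cexp).mul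
      (differentiable_laplace_measure (hSm m₁) hSM₁ hsupp₁)
  have hEbound : ∀ z, ‖E z‖ ≤ Real.exp (κ * max z.re 0) * L₁ := fun z => by
    have h := norm_cexp_mul_laplace_measure_le hSM₁ hsupp₁ z
    rwa [mul_assoc] at h
  have hAB : ∀ z, ‖E z‖ ≤ L₁ * Real.exp (κ * ‖z‖) := fun z => by
    refine (hEbound z).trans ?_
    rw [mul_comm]
    gcongr
    exact max_le (re_le_norm z) (norm_nonneg z)
  have hleft : ∀ z : ℂ, z.re ≤ 0 → ‖E z‖ ≤ L₁ := fun z hz => by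
    have h := hEbound z
    rwa [max_eq_right hz, mul_zero, Real.exp_zero, one_mul] at h
  -- bounded on the positive real axis (the decay hypothesis enters here)
  set X₁ : ℝ := max X₀ 0 with hX₁def
  set C₁ : ℝ := max (C + L) (Real.exp (κ * X₁) * L₁) with hC₁def
  have hreal : ∀ x : ℝ, 0 ≤ x → ‖E x‖ ≤ C₁ * Real.exp (0 * x) := fun x hx => by
    rw [zero_mul, Real.exp_zero, mul_one]
    rcases le_or_gt X₁ x with h | h
    · have hX₀ : X₀ ≤ x := (le_max_left _ _).trans h
      have h1 := htail x hx
      have h2 := hdecay x hX₀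
      have hx' : Real.exp (κ * x) * Real.exp (-κ * x) = 1 := by
        rw [← Real.exp_add, show κ * x + -κ * x = 0 by ring, Real.exp_zero]
      calc ‖E x‖ = Real.exp (κ * x) * ‖G₁ x‖ := by
            simp only [hEdef]
            rw [norm_mul, Complex.norm_exp, re_ofReal_mul, ofReal_re]
        _ ≤ Real.exp (κ * x) * (C * Real.exp (-κ * x) + Real.exp (-κ * x) * L) := by
            gcongr
            exact h1.trans (add_le_add h2 le_rfl)
        _ = C * (Real.exp (κ * x) * Real.exp (-κ * x)) +
              Real.exp (κ * x) * Real.exp (-κ * x) * L := by ring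
        _ = C + L := by rw [hx', mul_one, one_mul]
        _ ≤ C₁ := le_max_left _ _
    · have h1 := hEbound x
      rw [ofReal_re, max_eq_left hx] at h1
      calc ‖E x‖ ≤ Real.exp (κ * x) * L₁ := h1
        _ ≤ Real.exp (κ * X₁) * L₁ := by gcongr
        _ ≤ C₁ := le_max_right _ _
  -- bounded by `L₁` on the imaginary axis
  have himag : ∀ y : ℝ, ‖E (y * I)‖ ≤ L₁ * Real.exp (0 * |y|) := fun y => by
    rw [zero_mul, Real.exp_zero, mul_one]
    exact hleft _ (by simp)
  -- Phragmén–Lindelöf in the right half-plane, then Liouville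
  have hright : ∀ z : ℂ, 0 ≤ z.re → ‖E z‖ ≤ max C₁ L₁ := fun z hz => by
    have h := norm_le_exp_of_re_nonneg hEd hAB hreal himag hz
    rwa [zero_mul, zero_mul, add_zero, Real.exp_zero, mul_one] at h
  have hbdd : IsBounded (range E) := by
    rw [isBounded_iff_forall_norm_le]
    refine ⟨max C₁ L₁, ?_⟩
    rintro _ ⟨z, rfl⟩
    rcases le_total 0 z.re with hz | hz
    · exact hright z hz
    · exact (hleft z hz).trans (le_max_right _ _)
  have hconst : ∀ z w, E z = E w := fun z w => hEd.apply_eq_apply_of_bounded hbdd z w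
  -- the constant is `0`: `E(-n) → 0`
  have hlim : Tendsto (fun n : ℕ => E (((-(n : ℝ)) : ℝ) : ℂ)) atTop (𝓝 0) :=
    tendsto_cexp_mul_laplace_measure_atTop (hSm m₁) hSM₁ hsupp₁
  have hE0 : E 0 = 0 :=
    tendsto_const_nhds_iff.1 (hlim.congr fun n => hconst _ _)
  have hG₁ : ∀ z, G₁ z = 0 := fun z => by
    have h : E z = 0 := (hconst z 0).trans hE0
    exact (mul_eq_zero.1 h).resolve_left (Complex.exp_ne_zero _)
  -- hence the Fourier transform of `S dm₁` vanishes and `S = 0` `m₁`-a.e.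
  have hF : ∀ ξ : ℝ, ∫ l, S l * cexp (ξ * l * I) ∂m₁ = 0 := fun ξ => by
    have h := hG₁ (-(ξ : ℂ) * I)
    simp only [hG₁def] at h
    rw [← h]
    refine integral_congr_ae (Eventually.of_forall fun l => ?_)
    simp only
    rw [mul_comm (S l)]
    congr 2
    ring
  have hint₁ : Integrable S m₁ := Integrable.of_bound (hSm m₁) M₀ hSM₁
  have hae : S =ᵐ[m₁] 0 := ae_eq_zero_of_forall_integral_mul_cexp_eq_zero hint₁ hF
  have hae' : ∀ᵐ l ∂m, l ∈ Iio κ → S l = (0 : ℝ → ℂ) l :=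
    (ae_restrict_iff' measurableSet_Iio).1 hae
  filter_upwards [hae'] with l hl hlκ
  exact hl hlκ

/-- **Signed pairs.** Let `m₁, m₂` be finite positive measures on `ℝ` carried by `[0, ∞)`, `σ`
continuous and bounded, `α β : ℂ`, and suppose the Laplace transform of `σ · (α m₁ - β m₂)` decays:
`‖α ∫ e^{-lX} σ dm₁ - β ∫ e^{-lX} σ dm₂‖ ≤ C e^{-κX}` for `X ≥ X₀`. If on `(a, b)` with `b ≤ κ` the
measure `m₂` is dominated by `q · m₁` on measurable subsets with `‖β‖ q < ‖α‖`, and `m₁` charges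
every `(a', b')` with `a ≤ a' < b' ≤ b`, then `σ` vanishes on `(a, b)`. (Radon–Nikodym densities
`ρᵢ = dmᵢ/d(m₁ + m₂)`; the measurable version applied to `S = σ (α ρ₁ - β ρ₂)`; on `(a, b)` one has
`ρ₂ ≤ q ρ₁` and `ρ₁ > 0` a.e., so `α ρ₁ ≠ β ρ₂` and `σ = 0` `m₁`-a.e. there; continuity of `σ`.
The analytic input is Pólya's indicator theorem, Boas, *Entire Functions*, 1954, §5.4.)
[cite: Boas1954, §5.4] -/
theorem eqOn_zero_of_laplace_exp_decay_signedPair {m₁ m₂ : MeasureTheory.Measure ℝ}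
    [MeasureTheory.IsFiniteMeasure m₁] [MeasureTheory.IsFiniteMeasure m₂]
    (h₁ : m₁ (Set.Iio 0) = 0) (h₂ : m₂ (Set.Iio 0) = 0)
    {σ : ℝ → ℂ} (hσ : Continuous σ) {M : ℝ} (hσM : ∀ l, ‖σ l‖ ≤ M) (α β : ℂ)
    {κ C X₀ : ℝ} (hκ : 0 < κ)
    (hdecay : ∀ X : ℝ, X₀ ≤ X →
      ‖α * ∫ l, Complex.exp (-(l : ℂ) * X) * σ l ∂m₁ -
        β * ∫ l, Complex.exp (-(l : ℂ) * X) * σ l ∂m₂‖ ≤ C * Real.exp (-κ * X))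
    {a b q : ℝ} (hb : b ≤ κ) (hq : 0 ≤ q) (hαβ : ‖β‖ * q < ‖α‖)
    (hdom : ∀ A : Set ℝ, MeasurableSet A → A ⊆ Set.Ioo a b → m₂ A ≤ ENNReal.ofReal q * m₁ A)
    (hcharge : ∀ a' b' : ℝ, a ≤ a' → a' < b' → b' ≤ b → 0 < m₁ (Set.Ioo a' b')) :
    ∀ l ∈ Set.Ioo a b, σ l = 0 := by
  have hM0 : 0 ≤ M := (norm_nonneg _).trans (hσM 0)
  -- the reference measure `m = m₁ + m₂` and the Radon–Nikodym densities `ρ₁, ρ₂ ≤ 1`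
  set m : Measure ℝ := m₁ + m₂ with hmdef
  haveI : IsFiniteMeasure m := by rw [hmdef]; infer_instance
  have hle₁ : m₁ ≤ m := Measure.le_add_right le_rfl
  have hle₂ : m₂ ≤ m := Measure.le_add_left le_rfl
  have hac₁ : m₁ ≪ m := Measure.absolutelyContinuous_of_le hle₁
  have hac₂ : m₂ ≪ m := Measure.absolutelyContinuous_of_le hle₂
  have hsupp : m (Iio 0) = 0 := by rw [hmdef, Measure.add_apply, h₁, h₂, add_zero]
  have h0 : ∀ᵐ l ∂m, 0 ≤ l := by
    filter_upwards [measure_eq_zero_iff_ae_notMem.1 hsupp] with l hl using not_lt.1 hl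
  set ρ₁ : ℝ → ℝ≥0∞ := m₁.rnDeriv m with hρ₁def
  set ρ₂ : ℝ → ℝ≥0∞ := m₂.rnDeriv m with hρ₂def
  have hρ₁m : Measurable ρ₁ := Measure.measurable_rnDeriv _ _
  have hρ₂m : Measurable ρ₂ := Measure.measurable_rnDeriv _ _
  have hw₁ : m.withDensity ρ₁ = m₁ := Measure.withDensity_rnDeriv_eq _ _ hac₁
  have hw₂ : m.withDensity ρ₂ = m₂ := Measure.withDensity_rnDeriv_eq _ _ hac₂
  have hρ₁le : ∀ᵐ l ∂m, ρ₁ l ≤ 1 := Measure.rnDeriv_le_one_of_le hle₁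
  have hρ₂le : ∀ᵐ l ∂m, ρ₂ l ≤ 1 := Measure.rnDeriv_le_one_of_le hle₂
  have htoReal : ∀ {x : ℝ≥0∞}, x ≤ 1 → x.toReal ≤ 1 := fun hx => by
    simpa using ENNReal.toReal_mono ENNReal.one_ne_top hx
  -- the density `S = σ (α ρ₁ - β ρ₂)` of `σ (α m₁ - β m₂)` with respect to `m`
  set S : ℝ → ℂ := fun l => σ l * (α * ((ρ₁ l).toReal : ℂ) - β * ((ρ₂ l).toReal : ℂ)) with hSdef
  have hSmeas : Measurable S := by
    simp only [hSdef]
    fun_prop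
  have hSM : ∀ᵐ l ∂m, ‖S l‖ ≤ M * (‖α‖ + ‖β‖) := by
    filter_upwards [hρ₁le, hρ₂le] with l hl₁ hl₂
    simp only [hSdef]
    rw [norm_mul]
    refine mul_le_mul (hσM l) ((norm_sub_le _ _).trans (add_le_add ?_ ?_)) (norm_nonneg _) hM0
    · rw [norm_mul, Complex.norm_of_nonneg ENNReal.toReal_nonneg]
      exact mul_le_of_le_one_right (norm_nonneg _) (htoReal hl₁)
    · rw [norm_mul, Complex.norm_of_nonneg ENNReal.toReal_nonneg]
      exact mul_le_of_le_one_right (norm_nonneg _) (htoReal hl₂)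
  -- the Laplace transform of `S dm` is `α ∫ e^{-lX} σ dm₁ - β ∫ e^{-lX} σ dm₂` for `X ≥ 0`
  have hgi : ∀ {μ : Measure ℝ}, μ ≤ m → ∀ X : ℝ, 0 ≤ X →
      Integrable (fun l : ℝ => cexp (-(l : ℂ) * X) * σ l) μ := by
    intro μ hμ X hX
    haveI : IsFiniteMeasure μ := isFiniteMeasure_of_le m hμ
    refine Integrable.of_bound (Continuous.aestronglyMeasurable (by fun_prop)) M ?_
    filter_upwards [(Measure.absolutelyContinuous_of_le hμ).ae_le h0] with l hl
    rw [norm_mul, norm_cexp_neg_ofReal_mul, ofReal_re]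
    refine (mul_le_of_le_one_left (norm_nonneg _) (Real.exp_le_one_iff.2 ?_)).trans (hσM l)
    nlinarith
  have hLap : ∀ X : ℝ, 0 ≤ X → ∫ l, cexp (-(l : ℂ) * X) * S l ∂m =
      α * ∫ l, cexp (-(l : ℂ) * X) * σ l ∂m₁ - β * ∫ l, cexp (-(l : ℂ) * X) * σ l ∂m₂ := by
    intro X hX
    rw [← integral_rnDeriv_smul hac₁, ← integral_rnDeriv_smul hac₂, ← integral_const_mul,
      ← integral_const_mul, ← integral_sub]
    · refine integral_congr_ae (Eventually.of_forall fun l => ?_)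
      simp only [hSdef, real_smul]
      ring
    · exact ((integrable_rnDeriv_smul_iff hac₁).2 (hgi hle₁ X hX)).const_mul α
    · exact ((integrable_rnDeriv_smul_iff hac₂).2 (hgi hle₂ X hX)).const_mul β
  -- hence `S = 0` `m`-a.e. on `(-∞, κ)`
  have hS0 : ∀ᵐ l ∂m, l < κ → S l = 0 := by
    refine ae_eq_zero_of_laplace_exp_decay_measure_of_measurable hsupp hSmeas hSM hκ
      (C := C) (X₀ := max X₀ 0) fun X hX => ?_
    rw [hLap X ((le_max_right _ _).trans hX)]
    exact hdecay X ((le_max_left _ _).trans hX)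
  -- domination on `(a, b)`: `ρ₂ ≤ q ρ₁` and `ρ₁ ≠ 0` `m`-a.e. there
  have hρ₂q : ∀ᵐ l ∂m, l ∈ Ioo a b → ρ₂ l ≤ ENNReal.ofReal q * ρ₁ l := by
    rw [← ae_restrict_iff' measurableSet_Ioo]
    refine ae_le_of_forall_setLIntegral_le_of_sigmaFinite
      (g := fun l => ENNReal.ofReal q * ρ₁ l) hρ₂m fun s hs _ => ?_
    rw [lintegral_const_mul _ hρ₁m, Measure.restrict_restrict hs,
      ← withDensity_apply ρ₂ (hs.inter measurableSet_Ioo),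
      ← withDensity_apply ρ₁ (hs.inter measurableSet_Ioo), hw₁, hw₂]
    exact hdom _ (hs.inter measurableSet_Ioo) inter_subset_right
  have hρ₁0 : ∀ᵐ l ∂m, l ∈ Ioo a b → ρ₁ l ≠ 0 := by
    have hZ : MeasurableSet ({l | ρ₁ l = 0} ∩ Ioo a b) :=
      (hρ₁m (measurableSet_singleton 0)).inter measurableSet_Ioo
    have hZ₁ : m₁ ({l | ρ₁ l = 0} ∩ Ioo a b) = 0 := by
      rw [← hw₁, withDensity_apply _ hZ, setLIntegral_eq_zero_iff hZ hρ₁m]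
      exact Eventually.of_forall fun l hl => hl.1
    have hZ₂ : m₂ ({l | ρ₁ l = 0} ∩ Ioo a b) = 0 := by
      have h := hdom _ hZ inter_subset_right
      rw [hZ₁, mul_zero] at h
      exact nonpos_iff_eq_zero.1 h
    have hZm : m ({l | ρ₁ l = 0} ∩ Ioo a b) = 0 := by
      rw [hmdef, Measure.add_apply, hZ₁, hZ₂, add_zero]
    filter_upwards [measure_eq_zero_iff_ae_notMem.1 hZm] with l hl hlab hl0
    exact hl ⟨hl0, hlab⟩
  -- so `σ = 0` `m`-a.e., hence `m₁`-a.e., on `(a, b)`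
  have hσ0m : ∀ᵐ l ∂m, l ∈ Ioo a b → σ l = 0 := by
    filter_upwards [hS0, hρ₂q, hρ₁0, Measure.rnDeriv_lt_top m₁ m] with l hSl hql h0l hlt hlab
    have hlt' : ρ₁ l ≠ ⊤ := hlt.ne
    have hr₁ : 0 < (ρ₁ l).toReal := ENNReal.toReal_pos (h0l hlab) hlt'
    have hr₂ : (ρ₂ l).toReal ≤ q * (ρ₁ l).toReal := by
      have h := ENNReal.toReal_mono (ENNReal.mul_ne_top ENNReal.ofReal_ne_top hlt') (hql hlab)
      rwa [ENNReal.toReal_mul, ENNReal.toReal_ofReal hq] at h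
    have hSl' := hSl (hlab.2.trans_le hb)
    simp only [hSdef] at hSl'
    rcases mul_eq_zero.1 hSl' with h | h
    · exact h
    · exfalso
      have h' : ‖α‖ * (ρ₁ l).toReal = ‖β‖ * (ρ₂ l).toReal := by
        have h'' := congrArg norm (sub_eq_zero.1 h)
        rwa [norm_mul, norm_mul, Complex.norm_of_nonneg ENNReal.toReal_nonneg,
          Complex.norm_of_nonneg ENNReal.toReal_nonneg] at h''
      have h3 : ‖β‖ * (ρ₂ l).toReal ≤ ‖β‖ * (q * (ρ₁ l).toReal) :=
        mul_le_mul_of_nonneg_left hr₂ (norm_nonneg β)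
      have h4 : ‖β‖ * q * (ρ₁ l).toReal < ‖α‖ * (ρ₁ l).toReal :=
        mul_lt_mul_of_pos_right hαβ hr₁
      linarith
  have hσ0 : ∀ᵐ l ∂m₁, l ∈ Ioo a b → σ l = 0 := hac₁.ae_le hσ0m
  -- continuity of `σ` and `hcharge`
  intro l₀ hl₀
  by_contra hne
  obtain ⟨δ, hδ, hball⟩ := Metric.mem_nhds_iff.1 (hσ.continuousAt.eventually_ne hne)
  rw [Real.ball_eq_Ioo] at hball
  have hab' : max a (l₀ - δ) < min b (l₀ + δ) :=
    max_lt (lt_min (hl₀.1.trans hl₀.2) (by linarith [hl₀.1]))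
      (lt_min (by linarith [hl₀.2]) (by linarith))
  have hzero : m₁ (Ioo (max a (l₀ - δ)) (min b (l₀ + δ))) = 0 := by
    rw [measure_eq_zero_iff_ae_notMem]
    filter_upwards [hσ0] with l hl hlmem
    exact hball ⟨(le_max_right _ _).trans_lt hlmem.1, hlmem.2.trans_le (min_le_right _ _)⟩
      (hl ⟨(le_max_left _ _).trans_lt hlmem.1, hlmem.2.trans_le (min_le_left _ _)⟩)
  exact (hcharge _ _ (le_max_left _ _) hab' (min_le_left _ _)).ne' hzero

end Literature.Analysis.Complex
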